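import Summits.Parity.GeneralizedHardyLittlewood.Theorems.BeyondDiagonalBeatsQuarter.OffDiagPrincipalCoprimeBound
import Summits.Parity.GeneralizedHardyLittlewood.Theorems.BeyondDiagonalBeatsQuarter.OffDiagPrincipalStratum
import Summits.Parity.GeneralizedHardyLittlewood.Theorems.BeyondDiagonalBeatsQuarter.OffDiagCoreSplit
import Summits.Parity.GeneralizedHardyLittlewood.Theorems.BeyondDiagonalBeatsQuarter.OffDiagDualBoxSize
import HarnessLib

/-!
# Route `PrimeLevelFamEdge`, crux K_B (stmt-Parity-20343), line `diagonal_kernel_split` rev 4, plan Ω,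
# `OffDiagCoreTallCount` stage 2b (line lead 2026-08-28T17:02:08Z (2)): **the principal CELL of `coreP`, priced —
# `‖switchedCell K_P Hf q r l m d₁ d₂ i‖ ≤ 2·τ(ab)·(1 + log Hf)⁴·(2·2^{i₂})·(3/2·2^{i₁})·S_i`**

`OffDiagCoreSplit.coreP` is `Σ_{q∈G}` of the level bodies of the switched cells with the principal kernel
`K_P c A s h₁ q = levelPrincipal {q} 1 (switchMod c s h₁)`. For one cell `(r, l, m, d₁, d₂, i)` at the level `q` the
switched cell is `Σ_{|h₁| ≤ Hf, h₁ unit mod q(r+1)} Σ'_s 𝟙[stratum]·K_P·Φ̂_i(h₁/(q(r+1)), s/h₁ + ab/(h₁q(r+1)))`.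
This file bounds its norm, with no cancellation, through the chain
prover-5 `dvd_and_isUnit_class_iff_gcd_eq` (the stratum indicator is `gcd(s,h₁) = g₀ := gcd(ab,h₁)`, on which
`switchMod ≡ n₀ = |h₁|/g₀`) → `tsum_gcd_stratum_reindex` → stage 2a `norm_tsum_coprime_fourier2_intShift_le`
(`≤ τ(n₀)·B·S₁`) → `‖levelPrincipal {q} 1 n₀‖ ≤ φ(n₀)⁻¹` → the `h₁`-sum `Σ_{0<|h₁|≤H} τ(n₀)/φ(n₀) ≤ 2τ(ab)(1 + log H)⁴`
(fibres `h₁ = ±g·n`, stage 1 `sum_card_divisors_mul_totient_inv_le`):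

* §1 `norm_fourier_slice_boxWeight_le` — the slice bound `S₁ = (3/2)·2^{i₁}·S_i` of the box weight
  (`S_i = (d₁d₂K₁K₂/4)^{−1/2}·W(d₁d₂K₁K₂/(4q̂²))·r⁻¹`, `OffDiagDualBoxSize.norm_boxWeight_le` with `|J₁| ≤ 1`);
* §2 `norm_levelPrincipal_singleton_one_le` (`≤ φ(n)⁻¹`), `norm_tsum_stratum_fourier2_intShift_le`
  (`‖Σ'_s 𝟙[gcd(s,h₁)=g₀]Φ̂(ξ₁, s/h₁+τ)‖ ≤ τ(|h₁/g₀|)·B·S₁`), **`norm_tsum_principalKernel_le`** (the `s`-series of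
  the principal switched cell at one `h₁`: `≤ φ(n₀)⁻¹·τ(n₀)·B·S₁`, `n₀ = |h₁/gcd(A,h₁)|`);
* §3 **`sum_reducedModulus_le`** (`Σ_{h₁ ∈ [−H,H]∖0} f(n₀(h₁)) ≤ 2·τ(|A|)·Σ_{n≤H} f(n)` for `f ≥ 0`), `sum_card_divisors_mul_totient_inv_reducedModulus_le` (`≤ 2τ(|A|)(1 + log H)⁴`);
* §4 **`norm_switchedCell_principal_le`** — the headline cell bound above (`H = Hf q d₁ d₂ (l/d₁) (m/d₂) (r+1) i`).
Stage 2c (the level body `Σ_{r,l,m,d,i}|c_l c_m|·(4πq̂/q)·cell` and its `ms`-currency) follows. Bounds only; no def;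
helper toward `stub_offDiagBelowSlack_io` (`--supports stmt-Parity-20343`); closes nothing; standard axioms.
«The programme SEARCHES and TYPES; no claim about Landau–Siegel zeros, Theorems 1–2 of arXiv:2211.02515 or
a repaired Margin232 until a kernel theorem says so.»
-/

noncomputable section

open Real MeasureTheory Complex Finset
open scoped FourierTransform ArithmeticFunction.Moebius ContDiff

namespace Summit.Parity.GeneralizedHardyLittlewood.Theorems.BeyondDiagonalBeatsQuarter.OffDiag

open Literature.NumberTheory.LFunctions Literature.NumberTheory.LFunctions.KMV2000
open Literature.Analysis.FunctionSpaces (besselJ abs_besselJ_one_le_one)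
open Literature.NumberTheory.Sieve.FriedlanderIwaniecPrimes

/-! ### §1. The slice bound of a box weight -/

section Slice

variable {q d₁ d₂ α β r : ℕ}

/-- **Slice bound.** For `q, d₁, d₂ ≥ 1`, a box `i` and any height `y` and frequency `ξ`:
`‖𝓕(t₁ ↦ Φ_i(t₁, y))(ξ)‖ ≤ (3/2)·2^{i₁}·S_i`, `S_i = (d₁d₂K₁K₂/4)^{−1/2}·W(d₁d₂K₁K₂/(4q̂²))·r⁻¹` — the `t₁`-support has
length `(3/2)K₁` and `‖Φ_i‖ ≤ S_i` pointwise (`|J₁| ≤ 1`). [cite: KowalskiMichelVanderKam2000, (21)–(22) p. 12 — derivation] -/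
theorem norm_fourier_slice_boxWeight_le [NeZero q] (hd₁ : 1 ≤ d₁) (hd₂ : 1 ≤ d₂) (i : ℕ × ℕ) (y ξ : ℝ) :
    ‖𝓕 (fun t₁ : ℝ ↦ boxWeight q d₁ d₂ α β r i t₁ y) ξ‖ ≤
      3 / 2 * (2 : ℝ) ^ i.1 * (((d₁ : ℝ) * d₂ * ((2 : ℝ) ^ i.1 * 2 ^ i.2) / 4) ^ (-(1 / 2 : ℝ)) *
        cutoffW ((d₁ : ℝ) * d₂ * ((2 : ℝ) ^ i.1 * 2 ^ i.2) / 4 / qhat q ^ 2) * (r : ℝ)⁻¹ * 1) := by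
  set S : ℝ := ((d₁ : ℝ) * d₂ * ((2 : ℝ) ^ i.1 * 2 ^ i.2) / 4) ^ (-(1 / 2 : ℝ)) *
    cutoffW ((d₁ : ℝ) * d₂ * ((2 : ℝ) ^ i.1 * 2 ^ i.2) / 4 / qhat q ^ 2) * (r : ℝ)⁻¹ * 1 with hSdef
  have hS0 : 0 ≤ S := by
    have := cutoffW_nonneg ((d₁ : ℝ) * d₂ * ((2 : ℝ) ^ i.1 * 2 ^ i.2) / 4 / qhat q ^ 2)
    positivity
  have hpt : ∀ t₁ t₂ : ℝ, ‖boxWeight q d₁ d₂ α β r i t₁ t₂‖ ≤ S :=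
    norm_boxWeight_le hd₁ hd₂ i zero_le_one (fun x _ ↦ abs_besselJ_one_le_one x)
  set K₁ : ℝ := (2 : ℝ) ^ i.1 with hK₁
  have hK₁0 : 0 < K₁ := by positivity
  set I₁ : Set ℝ := Set.Icc (K₁ / 2) (2 * K₁) with hI₁
  have hm₁ : MeasurableSet I₁ := measurableSet_Icc
  have hv₁ : volume.real I₁ = 3 / 2 * K₁ := by rw [hI₁, Real.volume_real_Icc_of_le (by linarith)]; ring
  -- pointwise in `t₁`: `‖Φ(t₁, y)‖ ≤ S·𝟙_{I₁}(t₁)`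
  have hind : ∀ t₁ : ℝ, ‖boxWeight q d₁ d₂ α β r i t₁ y‖ ≤ I₁.indicator (fun _ ↦ S) t₁ := by
    intro t₁
    by_cases h : t₁ ∈ I₁
    · rw [Set.indicator_of_mem h]; exact hpt t₁ y
    · have h' : ¬ (t₁ ∈ Set.Icc ((2 : ℝ) ^ i.1 / 2) (2 * 2 ^ i.1) ∧
          y ∈ Set.Icc ((2 : ℝ) ^ i.2 / 2) (2 * 2 ^ i.2)) := fun hh ↦ h hh.1
      rw [boxWeight_eq_zero_of_not_mem h', norm_zero]
      exact Set.indicator_nonneg (fun _ _ ↦ hS0) _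
  have hint : Integrable (fun t₁ : ℝ ↦ I₁.indicator (fun _ ↦ S) t₁) :=
    (integrable_indicator_iff hm₁).2 (integrableOn_const (by rw [hI₁]; exact measure_Icc_lt_top.ne))
  calc ‖𝓕 (fun t₁ : ℝ ↦ boxWeight q d₁ d₂ α β r i t₁ y) ξ‖
      ≤ ∫ t₁, ‖boxWeight q d₁ d₂ α β r i t₁ y‖ := norm_fourier_le_integral_norm _ _
    _ ≤ ∫ t₁, I₁.indicator (fun _ ↦ S) t₁ :=
        integral_mono_of_nonneg (Filter.Eventually.of_forall fun _ ↦ norm_nonneg _) hint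
          (Filter.Eventually.of_forall hind)
    _ = 3 / 2 * K₁ * S := by rw [integral_indicator_const S hm₁, smul_eq_mul, hv₁]
    _ = 3 / 2 * (2 : ℝ) ^ i.1 * S := by rw [hK₁]

end Slice

/-! ### §2. The principal `s`-series at one dual modulus -/

section Principal

/-- `‖levelPrincipal {q} 1 n‖ ≤ φ(n)⁻¹` (the coprime sum of the single level is `0` or `1`). [folklore] -/
theorem norm_levelPrincipal_singleton_one_le (q n : ℕ) :
    ‖levelPrincipal {q} (fun _ ↦ (1 : ℂ)) n‖ ≤ ((Nat.totient n : ℝ))⁻¹ := by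
  classical
  rw [levelPrincipal, norm_mul, norm_inv, Complex.norm_natCast]
  refine mul_le_of_le_one_right (inv_nonneg.2 (Nat.cast_nonneg _)) ?_
  rw [levelCoprimeSum_eq_sum_ite, Finset.sum_singleton, mul_one]
  split_ifs <;> simp

variable {Φ : ℝ → ℝ → ℂ}

/-- **Trivial size of a stratum series.** For `uncurry Φ` smooth of compact support with heights in `(B₀, B)`
(`B₀, B ≥ 0`), `h₁ ≠ 0`, `g₀ ≥ 1` with `g₀ ∣ h₁`, and a slice bound `S₁`:
`‖Σ'_{s} 𝟙[gcd(s,h₁) = g₀]·Φ̂(ξ₁, s/h₁ + τ)‖ ≤ τ(|h₁/g₀|)·B·S₁` (re-index `s = g₀s′` and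
`norm_tsum_coprime_fourier2_intShift_le` at the modulus `h₁/g₀`). [folklore] -/
theorem norm_tsum_stratum_fourier2_intShift_le (hΦ : ContDiff ℝ ∞ (Function.uncurry Φ))
    (hΦc : HasCompactSupport (Function.uncurry Φ)) {B₀ B : ℝ} (hB₀ : 0 ≤ B₀) (hB : 0 ≤ B)
    (hsupp : ∀ t₁ t₂, Φ t₁ t₂ ≠ 0 → B₀ < t₂ ∧ t₂ < B) {h₁ : ℤ} (hh₁ : h₁ ≠ 0) {g₀ : ℕ} (hg₀ : 0 < g₀)
    (hdvd : (g₀ : ℤ) ∣ h₁) (τ ξ₁ : ℝ) {S₁ : ℝ} (hS₁ : 0 ≤ S₁)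
    (hslice : ∀ y : ℝ, ‖𝓕 (fun t₁ : ℝ ↦ Φ t₁ y) ξ₁‖ ≤ S₁) :
    ‖∑' s : ℤ, (if Int.gcd s h₁ = g₀ then fourier2 Φ ξ₁ ((s : ℝ) / h₁ + τ) else 0)‖ ≤
      ((h₁ / g₀).natAbs.divisors.card : ℝ) * B * S₁ := by
  have hg0 : (g₀ : ℤ) ≠ 0 := by exact_mod_cast hg₀.ne'
  obtain ⟨h', hh'⟩ := hdvd
  have hdiv : h₁ / g₀ = h' := by rw [hh', Int.mul_ediv_cancel_left _ hg0]
  have hh'0 : h' ≠ 0 := by rintro rfl; exact hh₁ (by rw [hh', mul_zero])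
  rw [tsum_gcd_stratum_reindex hg₀ ⟨h', hh'⟩]
  have hfreq : ∀ s' : ℤ, (((g₀ : ℤ) * s' : ℤ) : ℝ) / (h₁ : ℝ) = (s' : ℝ) / (h' : ℝ) := by
    intro s'
    rw [hh']
    push_cast
    have hg0R : (g₀ : ℝ) ≠ 0 := by exact_mod_cast hg₀.ne'
    have hh'R : (h' : ℝ) ≠ 0 := by exact_mod_cast hh'0
    field_simp
  simp_rw [hfreq, hdiv]
  exact norm_tsum_coprime_fourier2_intShift_le hΦ hΦc hB₀ hB hsupp hh'0 τ ξ₁ hS₁ hslice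

/-- **The principal `s`-series of a switched cell at one dual modulus, priced.** For a Petersson index `c`, a dual
modulus `h₁ ≠ 0` with `(c, h₁) = 1`, `A ∈ ℤ`, a level `q`, box data as above and a slice bound `S₁`:
`‖Σ'_s 𝟙[g ∣ A ∧ class unit]·levelPrincipal {q} 1 (switchMod c s h₁)·Φ̂(ξ₁, s/h₁ + τ)‖ ≤ φ(n₀)⁻¹·τ(n₀)·B·S₁`,
`n₀ = |h₁/gcd(A,h₁)|` (the stratum indicator is `gcd(s,h₁) = gcd(A,h₁)`, on which `switchMod c s h₁ = n₀`).
[folklore] -/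
theorem norm_tsum_principalKernel_le (hΦ : ContDiff ℝ ∞ (Function.uncurry Φ))
    (hΦc : HasCompactSupport (Function.uncurry Φ)) {B₀ B : ℝ} (hB₀ : 0 ≤ B₀) (hB : 0 ≤ B)
    (hsupp : ∀ t₁ t₂, Φ t₁ t₂ ≠ 0 → B₀ < t₂ ∧ t₂ < B) {c : ℕ} {h₁ : ℤ} (hh₁ : h₁ ≠ 0)
    (hc : IsCoprime (c : ℤ) h₁) (A : ℤ)
    {hdec : DecidablePred fun s : ℤ => ((switchGcd c s h₁ : ℤ) ∣ A ∧ IsUnit (switchClass c A s h₁))}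
    (q : ℕ) (τ ξ₁ : ℝ) {S₁ : ℝ} (hS₁ : 0 ≤ S₁)
    (hslice : ∀ y : ℝ, ‖𝓕 (fun t₁ : ℝ ↦ Φ t₁ y) ξ₁‖ ≤ S₁) :
    ‖∑' s : ℤ, (if ((switchGcd c s h₁ : ℤ) ∣ A ∧ IsUnit (switchClass c A s h₁)) then
        levelPrincipal {q} (fun _ ↦ (1 : ℂ)) (switchMod c s h₁) * fourier2 Φ ξ₁ ((s : ℝ) / h₁ + τ) else 0)‖ ≤
      ((Nat.totient (h₁ / (Int.gcd A h₁ : ℕ)).natAbs : ℝ))⁻¹ *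
        ((((h₁ / (Int.gcd A h₁ : ℕ)).natAbs.divisors.card : ℝ)) * B * S₁) := by
  classical
  set g₀ : ℕ := Int.gcd A h₁ with hg₀def
  have hg₀ : 0 < g₀ := Int.gcd_pos_of_ne_zero_right A hh₁
  have hg₀dvd : (g₀ : ℤ) ∣ h₁ := Int.gcd_dvd_right A h₁
  set n₀ : ℕ := (h₁ / (g₀ : ℤ)).natAbs with hn₀def
  -- the stratum indicator and the constancy of the reduced modulus on it
  have hind : ∀ s : ℤ, (((switchGcd c s h₁ : ℤ) ∣ A ∧ IsUnit (switchClass c A s h₁)) ↔ Int.gcd s h₁ = g₀) := by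
    intro s
    exact dvd_and_isUnit_class_iff_gcd_eq hh₁ hc A s rfl
  have hmod : ∀ s : ℤ, Int.gcd s h₁ = g₀ → switchMod c s h₁ = n₀ := by
    intro s hs
    have h1 : switchGcd c s h₁ = g₀ := by rw [switchGcd, intGcd_mul_left_eq_of_isCoprime hc s, hs]
    rw [switchMod, h1]
  -- rewrite the series as `levelPrincipal {q} 1 n₀ · (stratum series)`
  have hterm : ∀ s : ℤ, (if ((switchGcd c s h₁ : ℤ) ∣ A ∧ IsUnit (switchClass c A s h₁)) then
      levelPrincipal {q} (fun _ ↦ (1 : ℂ)) (switchMod c s h₁) * fourier2 Φ ξ₁ ((s : ℝ) / h₁ + τ) else 0) =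
        levelPrincipal {q} (fun _ ↦ (1 : ℂ)) n₀ *
          (if Int.gcd s h₁ = g₀ then fourier2 Φ ξ₁ ((s : ℝ) / h₁ + τ) else 0) := by
    intro s
    by_cases hs : Int.gcd s h₁ = g₀
    · rw [if_pos ((hind s).2 hs), if_pos hs, hmod s hs]
    · rw [if_neg (fun h ↦ hs ((hind s).1 h)), if_neg hs, mul_zero]
  rw [tsum_congr hterm, tsum_mul_left, norm_mul]
  exact mul_le_mul (norm_levelPrincipal_singleton_one_le q n₀)
    (norm_tsum_stratum_fourier2_intShift_le hΦ hΦc hB₀ hB hsupp hh₁ hg₀ hg₀dvd τ ξ₁ hS₁ hslice)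
    (norm_nonneg _) (inv_nonneg.2 (Nat.cast_nonneg _))

end Principal

/-! ### §3. Summing `τ(n₀)/φ(n₀)` over the dual moduli: the fibres `h₁ = ±g·n` -/

section ReducedModulus

/-- **Re-indexing the dual moduli by `(g, n₀) = (gcd(A,h₁), |h₁|/g)`.** For `A ≠ 0`, `H`, and `f ≥ 0`:
`Σ_{h₁ ∈ [−H, H], h₁ ≠ 0} f(|h₁/gcd(A,h₁)|) ≤ 2·τ(|A|)·Σ_{n ≤ H} f(n)` (each fibre is `{g·n, −g·n}`). [folklore] -/
theorem sum_reducedModulus_le {A : ℤ} (hA : A ≠ 0) (H : ℕ) (f : ℕ → ℝ) (hf : ∀ n, 0 ≤ f n) :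
    ∑ h₁ ∈ (Finset.Icc (-(H : ℤ)) H).filter (fun h₁ : ℤ => h₁ ≠ 0),
        f ((h₁ / (Int.gcd A h₁ : ℕ)).natAbs) ≤
      2 * ((A.natAbs.divisors.card : ℝ) * ∑ n ∈ Finset.Icc 1 H, f n) := by
  classical
  set S := (Finset.Icc (-(H : ℤ)) H).filter (fun h₁ : ℤ => h₁ ≠ 0) with hS
  set T := A.natAbs.divisors ×ˢ Finset.Icc 1 H with hT
  set φ : ℤ → ℕ × ℕ := fun h₁ => (Int.gcd A h₁, (h₁ / (Int.gcd A h₁ : ℕ)).natAbs) with hφ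
  have hdec : ∀ h₁ : ℤ, h₁ = (Int.gcd A h₁ : ℤ) * (h₁ / (Int.gcd A h₁ : ℕ)) := fun h₁ =>
    (Int.mul_ediv_cancel' (Int.gcd_dvd_right A h₁)).symm
  have hmaps : ∀ h₁ ∈ S, φ h₁ ∈ T := by
    intro h₁ hh
    obtain ⟨hI, hne⟩ := Finset.mem_filter.1 hh
    obtain ⟨hlo, hhi⟩ := Finset.mem_Icc.1 hI
    have hg0 : 0 < Int.gcd A h₁ := Int.gcd_pos_of_ne_zero_left h₁ hA
    have hq0 : h₁ / (Int.gcd A h₁ : ℕ) ≠ 0 := by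
      intro h0
      have := hdec h₁
      rw [h0, mul_zero] at this
      exact hne this
    refine Finset.mem_product.2 ⟨Nat.mem_divisors.2 ⟨?_, Int.natAbs_ne_zero.2 hA⟩, Finset.mem_Icc.2 ⟨?_, ?_⟩⟩
    · exact Int.natCast_dvd.1 (Int.gcd_dvd_left A h₁)
    · exact Int.natAbs_pos.2 hq0
    · -- `|h₁/g| ≤ |h₁| ≤ H`
      have h1 : (h₁ / (Int.gcd A h₁ : ℕ)).natAbs ≤ h₁.natAbs := by
        conv_rhs => rw [hdec h₁]
        rw [Int.natAbs_mul, Int.natAbs_natCast]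
        exact Nat.le_mul_of_pos_left _ hg0
      have h2 : h₁.natAbs ≤ H := by
        have : (h₁.natAbs : ℤ) ≤ H := by rw [Int.natCast_natAbs]; exact abs_le.2 ⟨hlo, hhi⟩
        exact_mod_cast this
      exact h1.trans h2
  -- each fibre has at most two elements
  have hfib : ∀ y ∈ T, ((S.filter (fun h₁ => φ h₁ = y)).card : ℝ) ≤ 2 := by
    intro y _
    have hsub : S.filter (fun h₁ => φ h₁ = y) ⊆ ({(y.1 : ℤ) * y.2, -((y.1 : ℤ) * y.2)} : Finset ℤ) := by
      intro h₁ hh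
      have hφy : φ h₁ = y := (Finset.mem_filter.1 hh).2
      have hg : Int.gcd A h₁ = y.1 := by rw [← hφy]
      have hn : (h₁ / (Int.gcd A h₁ : ℕ)).natAbs = y.2 := by rw [← hφy]
      rw [Finset.mem_insert, Finset.mem_singleton]
      rcases Int.natAbs_eq (h₁ / (Int.gcd A h₁ : ℕ)) with h | h
      · left
        calc h₁ = (Int.gcd A h₁ : ℤ) * (h₁ / (Int.gcd A h₁ : ℕ)) := hdec h₁
          _ = (Int.gcd A h₁ : ℤ) * ((h₁ / (Int.gcd A h₁ : ℕ)).natAbs : ℤ) := by rw [← h]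
          _ = (y.1 : ℤ) * (y.2 : ℤ) := by rw [hn, hg]
      · right
        calc h₁ = (Int.gcd A h₁ : ℤ) * (h₁ / (Int.gcd A h₁ : ℕ)) := hdec h₁
          _ = (Int.gcd A h₁ : ℤ) * (-((h₁ / (Int.gcd A h₁ : ℕ)).natAbs : ℤ)) := by rw [← h]
          _ = -((y.1 : ℤ) * (y.2 : ℤ)) := by rw [hn, hg]; ring
    calc ((S.filter (fun h₁ => φ h₁ = y)).card : ℝ)
        ≤ (({(y.1 : ℤ) * y.2, -((y.1 : ℤ) * y.2)} : Finset ℤ).card : ℝ) := by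
          exact_mod_cast Finset.card_le_card hsub
      _ ≤ 2 := by exact_mod_cast Finset.card_le_two
  -- regroup by fibres
  have hre : ∑ h₁ ∈ S, f ((h₁ / (Int.gcd A h₁ : ℕ)).natAbs) = ∑ h₁ ∈ S, f (φ h₁).2 := rfl
  rw [hre, ← Finset.sum_fiberwise_of_maps_to' hmaps (fun y : ℕ × ℕ => f y.2)]
  calc ∑ y ∈ T, ∑ h₁ ∈ S.filter (fun h₁ => φ h₁ = y), f y.2
      = ∑ y ∈ T, ((S.filter (fun h₁ => φ h₁ = y)).card : ℝ) * f y.2 := by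
        refine Finset.sum_congr rfl fun y _ => ?_
        rw [Finset.sum_const, nsmul_eq_mul]
    _ ≤ ∑ y ∈ T, 2 * f y.2 := Finset.sum_le_sum fun y hy => mul_le_mul_of_nonneg_right (hfib y hy) (hf _)
    _ = 2 * ((A.natAbs.divisors.card : ℝ) * ∑ n ∈ Finset.Icc 1 H, f n) := by
        rw [hT, Finset.sum_product]
        simp only [Finset.sum_const, ← Finset.mul_sum]
        ring

/-- **The `h₁`-sum of the principal cell**: `Σ_{h₁ ∈ [−H,H], h₁ ≠ 0} τ(n₀)/φ(n₀) ≤ 2·τ(|A|)·(1 + log H)⁴`,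
`n₀ = |h₁/gcd(A,h₁)|` (`sum_reducedModulus_le` + stage 1 `sum_card_divisors_mul_totient_inv_le`). [folklore] -/
theorem sum_card_divisors_mul_totient_inv_reducedModulus_le {A : ℤ} (hA : A ≠ 0) (H : ℕ) :
    ∑ h₁ ∈ (Finset.Icc (-(H : ℤ)) H).filter (fun h₁ : ℤ => h₁ ≠ 0),
        (((h₁ / (Int.gcd A h₁ : ℕ)).natAbs.divisors.card : ℝ) *
          ((Nat.totient (h₁ / (Int.gcd A h₁ : ℕ)).natAbs : ℝ))⁻¹) ≤
      2 * (A.natAbs.divisors.card : ℝ) * (1 + Real.log H) ^ 4 := by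
  have h1 := sum_reducedModulus_le hA H
    (fun n => (n.divisors.card : ℝ) * ((Nat.totient n : ℝ))⁻¹)
    (fun n => mul_nonneg (Nat.cast_nonneg _) (inv_nonneg.2 (Nat.cast_nonneg _)))
  refine h1.trans ?_
  rw [mul_assoc]
  refine mul_le_mul_of_nonneg_left ?_ (by norm_num)
  exact mul_le_mul_of_nonneg_left (sum_card_divisors_mul_totient_inv_le H) (Nat.cast_nonneg _)

end ReducedModulus

/-! ### §4. The principal switched cell, priced -/

section Cell

variable {q : ℕ} [NeZero q]

omit [NeZero q] in
/-- A unit dual modulus mod `q·c ≥ 2` is nonzero and coprime to the Petersson index `c`. [folklore] -/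
theorem ne_zero_and_isCoprime_of_isUnit {c : ℕ} (hqc : 2 ≤ q * c) {h₁ : ℤ}
    (hu : IsUnit ((h₁ : ℤ) : ZMod (q * c))) : h₁ ≠ 0 ∧ IsCoprime (c : ℤ) h₁ := by
  have hcop : IsCoprime ((q * c : ℕ) : ℤ) h₁ := (ZMod.coe_int_isUnit_iff_isCoprime h₁ (q * c)).1 hu
  refine ⟨?_, ?_⟩
  · rintro rfl
    rw [isCoprime_zero_right, Int.isUnit_iff] at hcop
    omega
  · push_cast at hcop
    exact hcop.of_mul_left_right

open Classical in
/-- **The principal switched cell of `coreP`, priced.** For a prime-size level `q ≥ 2`, any height function `Hf`,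
a cell `(r, l, m, d₁, d₂, i)` with `d₁, d₂ ≥ 1`, `a = l/d₁ ≥ 1`, `b = m/d₂ ≥ 1`, and `H = Hf q d₁ d₂ a b (r+1) i`:
`‖switchedCell K_P Hf q r l m d₁ d₂ i‖ ≤ 2·τ(ab)·(1 + log H)⁴·2^{i₂+1}·((3/2)·2^{i₁}·S_i)`,
`S_i = (d₁d₂K₁K₂/4)^{−1/2}·W(d₁d₂K₁K₂/(4q̂²))·(r+1)⁻¹`, `K_P c A s h₁ q = levelPrincipal {q} 1 (switchMod c s h₁)` —
per `h₁`: `norm_tsum_principalKernel_le`; over `h₁`: `sum_card_divisors_mul_totient_inv_reducedModulus_le`. This is the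
trivial MASS of the principal piece per cell, tall and short moduli alike (the «a8P-TALL ≈ U × L» row before the layer sum).
[cite: KowalskiMichelVanderKam2000, §6 p. 19, (21)–(23) p. 12 — derivation] -/
theorem norm_switchedCell_principal_le (hq : 2 ≤ q) (Hf : ℕ → ℕ → ℕ → ℕ → ℕ → ℕ → ℕ × ℕ → ℕ)
    {r l m d₁ d₂ : ℕ} (hd₁ : 1 ≤ d₁) (hd₂ : 1 ≤ d₂) (hl : 1 ≤ l / d₁) (hm : 1 ≤ m / d₂) (i : ℕ × ℕ) :
    ‖switchedCell (fun c _ s h₁ q ↦ levelPrincipal {q} (fun _ ↦ (1 : ℂ)) (switchMod c s h₁)) Hf q r l m d₁ d₂ i‖ ≤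
      2 * ((((l / d₁) * (m / d₂) : ℕ)).divisors.card : ℝ) *
        (1 + Real.log (Hf q d₁ d₂ (l / d₁) (m / d₂) (r + 1) i)) ^ 4 *
        ((2 : ℝ) ^ (i.2 + 1) * (3 / 2 * (2 : ℝ) ^ i.1 *
          (((d₁ : ℝ) * d₂ * ((2 : ℝ) ^ i.1 * 2 ^ i.2) / 4) ^ (-(1 / 2 : ℝ)) *
            cutoffW ((d₁ : ℝ) * d₂ * ((2 : ℝ) ^ i.1 * 2 ^ i.2) / 4 / qhat q ^ 2) * (((r + 1 : ℕ) : ℝ))⁻¹ * 1))) := by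
  set H : ℕ := Hf q d₁ d₂ (l / d₁) (m / d₂) (r + 1) i with hH
  set A : ℤ := ((l / d₁ : ℕ) : ℤ) * (m / d₂ : ℕ) with hA
  have hA0 : A ≠ 0 := by
    rw [hA]
    exact_mod_cast (Nat.mul_pos hl hm).ne'
  have hAabs : A.natAbs = (l / d₁) * (m / d₂) := by
    rw [hA, Int.natAbs_mul, Int.natAbs_natCast, Int.natAbs_natCast]
  set B : ℝ := (2 : ℝ) ^ (i.2 + 1) with hB
  have hB0 : 0 ≤ B := by positivity
  set S₁ : ℝ := 3 / 2 * (2 : ℝ) ^ i.1 *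
    (((d₁ : ℝ) * d₂ * ((2 : ℝ) ^ i.1 * 2 ^ i.2) / 4) ^ (-(1 / 2 : ℝ)) *
      cutoffW ((d₁ : ℝ) * d₂ * ((2 : ℝ) ^ i.1 * 2 ^ i.2) / 4 / qhat q ^ 2) * (((r + 1 : ℕ) : ℝ))⁻¹ * 1) with hS₁
  have hS₁0 : 0 ≤ S₁ := by
    have := cutoffW_nonneg ((d₁ : ℝ) * d₂ * ((2 : ℝ) ^ i.1 * 2 ^ i.2) / 4 / qhat q ^ 2)
    positivity
  have hΦ := contDiff_uncurry_boxWeight (q := q) (r := r + 1) hd₁ hd₂ hl hm i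
  have hΦc := hasCompactSupport_uncurry_boxWeight (q := q) (d₁ := d₁) (d₂ := d₂) (α := l / d₁) (β := m / d₂)
    (r := r + 1) i
  have hsupp := boxWeight_height (q := q) (d₁ := d₁) (d₂ := d₂) (α := l / d₁) (β := m / d₂) (r := r + 1) i
  have hB₀ : (0 : ℝ) ≤ (2 : ℝ) ^ i.2 / 2 := by positivity
  have hslice : ∀ ξ y : ℝ, ‖𝓕 (fun t₁ : ℝ ↦ boxWeight q d₁ d₂ (l / d₁) (m / d₂) (r + 1) i t₁ y) ξ‖ ≤ S₁ :=
    fun ξ y ↦ norm_fourier_slice_boxWeight_le (α := l / d₁) (β := m / d₂) (r := r + 1) hd₁ hd₂ i y ξ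
  have hqc : 2 ≤ q * (r + 1) := le_trans hq (Nat.le_mul_of_pos_right _ (Nat.succ_pos r))
  -- the per-modulus majorant
  set f : ℤ → ℝ := fun h₁ ↦ ((((h₁ / (Int.gcd A h₁ : ℕ)).natAbs.divisors.card : ℝ)) *
    ((Nat.totient (h₁ / (Int.gcd A h₁ : ℕ)).natAbs : ℝ))⁻¹) with hf
  have hf0 : ∀ h₁, 0 ≤ f h₁ := fun h₁ ↦ mul_nonneg (Nat.cast_nonneg _) (inv_nonneg.2 (Nat.cast_nonneg _))
  have hRHS : 0 ≤ 2 * ((((l / d₁) * (m / d₂) : ℕ)).divisors.card : ℝ) * (1 + Real.log H) ^ 4 * (B * S₁) := by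
    have : 0 ≤ 1 + Real.log H := by have := Real.log_natCast_nonneg H; linarith
    positivity
  rw [switchedCell]
  by_cases hcop : Nat.Coprime (l / d₁) (r + 1)
  · rw [if_pos hcop]
    refine ((norm_sum_le _ _).trans (Finset.sum_le_sum
      (g := fun h₁ : ℤ ↦ if h₁ ≠ 0 then B * S₁ * f h₁ else 0) fun h₁ _ ↦ ?_)).trans ?_
    · -- one dual modulus
      by_cases hu : IsUnit ((h₁ : ℤ) : ZMod (q * (r + 1)))
      · obtain ⟨hne, hc⟩ := ne_zero_and_isCoprime_of_isUnit hqc hu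
        rw [if_pos hu, if_pos hne]
        refine (norm_tsum_principalKernel_le hΦ hΦc hB₀ hB0 hsupp hne hc A q _ _ hS₁0 (hslice _)).trans
          (le_of_eq ?_)
        simp only [hf]
        ring
      · rw [if_neg hu, norm_zero]
        by_cases hne : h₁ ≠ 0
        · rw [if_pos hne]; exact mul_nonneg (mul_nonneg hB0 hS₁0) (hf0 _)
        · rw [if_neg hne]
    · -- the `h₁`-sum
      rw [← Finset.sum_filter, ← Finset.mul_sum]
      calc B * S₁ * ∑ h₁ ∈ (Finset.Icc (-(H : ℤ)) H).filter (fun h₁ : ℤ => h₁ ≠ 0), f h₁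
          ≤ B * S₁ * (2 * (A.natAbs.divisors.card : ℝ) * (1 + Real.log H) ^ 4) :=
            mul_le_mul_of_nonneg_left (sum_card_divisors_mul_totient_inv_reducedModulus_le hA0 H)
              (mul_nonneg hB0 hS₁0)
        _ = 2 * ((((l / d₁) * (m / d₂) : ℕ)).divisors.card : ℝ) * (1 + Real.log H) ^ 4 * (B * S₁) := by
            rw [hAabs]; ring
  · rw [if_neg hcop, norm_zero]
    exact hRHS

end Cell



end Summit.Parity.GeneralizedHardyLittlewood.Theorems.BeyondDiagonalBeatsQuarter.OffDiag
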